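import Summits.QuantumFields.GaugeBoot.TiltedRPPositivity
import HarnessLib

/-!
# Site frames on a periodic lattice: reflection in a lattice hyperplane `x_k = 0` (gauge-boot, L3(τ) part 1)

HONEST FRAMING (cell `pub-gaugeboot`, page 1 of every file): the venture produces certified bounds
on lattice expectations at stated coupling, gauge group, dimension and torus size; NOT a mass gap,
NOT a continuum limit, NOT a string tension; NOT Yang–Mills-summit-bearing (barriers
`FixedCouplingUltralocality`, `PerturbativeInvisibility`).

Companion of `TiltedRPGeometry.lean` / `TiltedRPPlaquettes.lean` for the OTHER reflection family
available on the 45°-tilted periodic box of Fröhlich–Israel–Lieb–Simon (`TiltedBox.lean`): the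
reflection `x_k ↦ -x_k` in a lattice hyperplane THROUGH SITES orthogonal to an axis `k` (for the
tilted box: an axis `k ∉ {i, j}` with even period). On a periodic lattice (finite additive
commutative site group `A`, marked translations `e : Fin d → A`) a **site frame**
`IsSiteFrame e k θ P h` consists of the reflection `θ : A →+ A` (involution, `θ (e k) = -e k`,
`θ (e l) = e l` for `l ≠ k`), the height `h : A →+ ZMod (2P)` (`h (e k) = 1`, `h (e l) = 0`,
`h ∘ θ = -h`, `P ≥ 2`) and the axiom that both layers `h = 0`, `h = P` are pointwise fixed — which
holds automatically in a direction of even period `2P` (`x - θx = 2 x_k e_k`), cf.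
`TiltedBoxSiteRP.lean`.

Differences with the diagonal case: the `k`-links are REVERSED by the reflection
(`siteLinkMap (x, k) = (θx - e_k, k)`, and `configReflect` inverts their variables — the
Osterwalder–Seiler reflection `Θ`), and NO plaquette is cut: a plaquette with a `k`-side based at
height `c` spans heights `c, c + 1` and is positive (`c + 1 ≤ P`) or negative; a plaquette without
`k`-side lies at one height and is positive, negative or a MIRROR plaquette (inside a layer). The
closed half, its links, the layers and the mirror / positive links are those of
`TiltedRPGeometry.lean` with `i = j = k` (`IsHalfLink e P h`, `IsMirrorLink k k P h`, …).
Contents: the frame, `siteLinkMap` / `configReflect` (involutions), positive links are carried out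
of the closed half (`not_isHalfLink_siteLinkMap`). The plaquette classes and the plaquette reflection
`plaqReflect` are in `TiltedSiteRPPlaquettes.lean`; holonomies in `TiltedSiteRPHolonomy.lean`;
the positivity theorem in `TiltedSiteRPPositivity.lean`; the tilted-box instance in
`TiltedBoxSiteRP.lean`.

References: K. Osterwalder, E. Seiler, Ann. Phys. 110 (1978) 440, §2; J. Fröhlich, R. Israel,
E. H. Lieb, B. Simon, Comm. Math. Phys. 62 (1978) 1, Thm. 2.1 (reflection through sites);
J. Glimm, A. Jaffe, Quantum Physics (2nd ed.) Thm. 7.10.2 (torus reflections in cross-sections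
dividing the torus in two equal parts).
-/

namespace Summit.QuantumFields.GaugeBoot

namespace TiltedRP

variable {A : Type*} [AddCommGroup A] {d : ℕ}

/-! ## Site frames -/

/-- **A site frame** on the periodic lattice `(A, e)` in direction `k`: the reflection `θ`
(additive involution, `θ (e k) = -e k`, `θ (e l) = e l` for `l ≠ k`), the half period `P ≥ 2` and
the height `h : A →+ ZMod (2P)` (`h (e k) = 1`, `h (e l) = 0` for `l ≠ k`, `h ∘ θ = -h`) with both
layers `h = 0`, `h = P` pointwise fixed by `θ`. -/
structure IsSiteFrame (e : Fin d → A) (k : Fin d) (θ : A →+ A) (P : ℕ) (h : A →+ ZMod (2 * P)) :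
    Prop where
  /-- The half period is at least `2`. -/
  two_le : 2 ≤ P
  /-- The reflection reverses `e k`. -/
  map_e_self : θ (e k) = -e k
  /-- The reflection fixes the other translations. -/
  map_e_other : ∀ l, l ≠ k → θ (e l) = e l
  /-- The reflection is an involution. -/
  invol : ∀ x, θ (θ x) = x
  /-- The height increases by one along `e k`. -/
  height_self : h (e k) = 1
  /-- The height is constant along the other translations. -/
  height_other : ∀ l, l ≠ k → h (e l) = 0
  /-- The reflection reverses the height. -/
  height_map : ∀ x, h (θ x) = -h x
  /-- Both layers `h = 0` and `h = P` are pointwise fixed by the reflection. -/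
  fix_of_layer : ∀ x, h x = 0 ∨ h x = (P : ZMod (2 * P)) → θ x = x

/-! ## The reflection on links and configurations -/

/-- The reflection of positively oriented links: `(x, l) ↦ (θx, l)` for `l ≠ k`, while the `k`-link
`x → x + e_k` is carried onto the link `θx - e_k → θx`, i.e. onto `(θx - e_k, k)` traversed
BACKWARDS. -/
def siteLinkMap (e : Fin d → A) (k : Fin d) (θ : A →+ A) (l : Link A d) : Link A d :=
  (θ l.1 + (if l.2 = k then -e k else 0), l.2)

/-- The Osterwalder–Seiler reflection `Θ` of configurations: `(ΘU)(x, l) = U(θx, l)` for `l ≠ k`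
and `(ΘU)(x, k) = U(θx - e_k, k)⁻¹` (the reversed `k`-links carry the inverse). -/
noncomputable def configReflect {G : Type*} [Group G] (e : Fin d → A) (k : Fin d) (θ : A →+ A)
    (U : Config A d G) : Config A d G :=
  fun l => if l.2 = k then (U (siteLinkMap e k θ l))⁻¹ else U (siteLinkMap e k θ l)

/-- `siteLinkMap` on a `k`-link. -/
@[simp] theorem siteLinkMap_self (e : Fin d → A) (k : Fin d) (θ : A →+ A) (x : A) :
    siteLinkMap e k θ (x, k) = (θ x - e k, k) := by
  simp [siteLinkMap, sub_eq_add_neg]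

/-- `siteLinkMap` on an `l`-link, `l ≠ k`. -/
theorem siteLinkMap_other (e : Fin d → A) (k : Fin d) (θ : A →+ A) (x : A) {l : Fin d}
    (hl : l ≠ k) : siteLinkMap e k θ (x, l) = (θ x, l) := by
  simp [siteLinkMap, hl]

/-- `configReflect` on a `k`-link. -/
@[simp] theorem configReflect_self {G : Type*} [Group G] (e : Fin d → A) (k : Fin d) (θ : A →+ A)
    (U : Config A d G) (x : A) : configReflect e k θ U (x, k) = (U (θ x - e k, k))⁻¹ := by
  simp [configReflect]

/-- `configReflect` on an `l`-link, `l ≠ k`. -/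
theorem configReflect_other {G : Type*} [Group G] (e : Fin d → A) (k : Fin d) (θ : A →+ A)
    (U : Config A d G) (x : A) {l : Fin d} (hl : l ≠ k) :
    configReflect e k θ U (x, l) = U (θ x, l) := by
  simp [configReflect, hl, siteLinkMap_other e k θ x hl]

namespace IsSiteFrame

variable {e : Fin d → A} {k : Fin d} {θ : A →+ A} {P : ℕ} {h : A →+ ZMod (2 * P)}
variable (hF : IsSiteFrame e k θ P h)
include hF

/-- `θ (x + e k) = θ x - e k`. -/
theorem map_add_self (x : A) : θ (x + e k) = θ x - e k := by
  rw [map_add, hF.map_e_self, sub_eq_add_neg]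

/-- `θ (x + e l) = θ x + e l` for `l ≠ k`. -/
theorem map_add_other (x : A) {l : Fin d} (hl : l ≠ k) : θ (x + e l) = θ x + e l := by
  rw [map_add, hF.map_e_other l hl]

/-- `θ (x - e k) = θ x + e k`. -/
theorem map_sub_self (x : A) : θ (x - e k) = θ x + e k := by
  rw [map_sub, hF.map_e_self, sub_neg_eq_add]

/-- `siteLinkMap` is an involution. -/
@[simp] theorem siteLinkMap_siteLinkMap (l : Link A d) :
    siteLinkMap e k θ (siteLinkMap e k θ l) = l := by
  obtain ⟨x, m⟩ := l
  by_cases hm : m = k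
  · subst hm
    rw [siteLinkMap_self, siteLinkMap_self, hF.map_sub_self, hF.invol, add_sub_cancel_right]
  · rw [siteLinkMap_other e k θ x hm, siteLinkMap_other e k θ _ hm, hF.invol]

/-- `siteLinkMap` is involutive. -/
theorem siteLinkMap_involutive : Function.Involutive (siteLinkMap (d := d) e k θ) :=
  hF.siteLinkMap_siteLinkMap

/-- `configReflect` is an involution. -/
theorem configReflect_configReflect {G : Type*} [Group G] (U : Config A d G) :
    configReflect e k θ (configReflect e k θ U) = U := by
  funext l
  obtain ⟨x, m⟩ := l
  by_cases hm : m = k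
  · subst hm
    rw [configReflect_self, configReflect_self, hF.map_sub_self, hF.invol, add_sub_cancel_right,
      inv_inv]
  · rw [configReflect_other e k θ _ x hm, configReflect_other e k θ U _ hm, hF.invol]

/-! ## Heights -/

/-- Height along `e k`: `h (x + e k) = h x + 1`. -/
theorem height_add_self (x : A) : h (x + e k) = h x + 1 := by rw [map_add, hF.height_self]

/-- Height along `e l`, `l ≠ k`: unchanged. -/
theorem height_add_other (x : A) {l : Fin d} (hl : l ≠ k) : h (x + e l) = h x := by
  rw [map_add, hF.height_other l hl, add_zero]

/-- Height below: `h (x - e k) = h x - 1`. -/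
theorem height_sub_self (x : A) : h (x - e k) = h x - 1 := by rw [map_sub, hF.height_self]

/-- `val` of the height along `e k`. -/
theorem val_height_add_self (x : A) :
    (h (x + e k)).val = if (h x).val + 1 = 2 * P then 0 else (h x).val + 1 := by
  rw [hF.height_add_self, val_add_one hF.two_le]

/-- `val` of the height of the reflected site. -/
theorem val_height_map (x : A) : (h (θ x)).val = if (h x).val = 0 then 0 else 2 * P - (h x).val := by
  rw [hF.height_map, val_neg hF.two_le]

/-- `val` of the height of the reflected site lowered by `e k`: `2P - 1 - c` (no wrap-around). -/
theorem val_height_map_sub (x : A) : (h (θ x - e k)).val = 2 * P - 1 - (h x).val := by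
  have hP := hF.two_le
  have hc := val_lt_two_mul hP (h x)
  rw [hF.height_sub_self, val_sub_one hP, hF.val_height_map]
  split_ifs <;> omega

/-- The layers in terms of `val`. -/
theorem layer_iff_val (x : A) :
    (h x = 0 ∨ h x = (P : ZMod (2 * P))) ↔ ((h x).val = 0 ∨ (h x).val = P) := by
  rw [eq_zero_iff_val, eq_natCast_iff_val hF.two_le]

/-- The reflection preserves the layers. -/
theorem layer_map_iff (x : A) :
    (h (θ x) = 0 ∨ h (θ x) = (P : ZMod (2 * P))) ↔ (h x = 0 ∨ h x = (P : ZMod (2 * P))) := by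
  rw [hF.height_map, neg_eq_zero, neg_eq_iff_eq_neg, neg_natCast_self]

/-! ## Links of the closed half under the reflection -/

/-- Layer sites are fixed by the reflection. -/
theorem map_of_isLayer {x : A} (hx : IsLayer P h x) : θ x = x := hF.fix_of_layer x hx

/-- Layer sites lie in the closed half. -/
theorem inHalf_of_isLayer {x : A} (hx : IsLayer P h x) : InHalf P h x := by
  have h1 := (hF.layer_iff_val x).1 hx
  have hP := hF.two_le
  unfold InHalf; omega

/-- **Mirror links (inside a layer, direction `≠ k`) are fixed by `siteLinkMap`.** -/
theorem siteLinkMap_of_isMirrorLink {l : Link A d} (hl : IsMirrorLink k k P h l) :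
    siteLinkMap e k θ l = l := by
  obtain ⟨x, m⟩ := l
  obtain ⟨h1, h2, -⟩ := hl
  rw [siteLinkMap_other e k θ x h2, hF.map_of_isLayer h1]

/-- Mirror links are links of the closed half. -/
theorem isHalfLink_of_isMirrorLink {l : Link A d} (hl : IsMirrorLink k k P h l) :
    IsHalfLink e P h l := by
  obtain ⟨x, m⟩ := l
  obtain ⟨h1, h2, -⟩ := hl
  refine ⟨hF.inHalf_of_isLayer h1, ?_⟩
  show InHalf P h (x + e m)
  unfold InHalf
  rw [hF.height_add_other x h2]
  exact hF.inHalf_of_isLayer h1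

/-- The links of the closed half are the positive links and the mirror links. -/
theorem isHalfLink_iff_pos_or_mirror (l : Link A d) :
    IsHalfLink e P h l ↔ IsPosLink e k k P h l ∨ IsMirrorLink k k P h l := by
  constructor
  · intro hl
    by_cases hm : IsMirrorLink k k P h l
    · exact Or.inr hm
    · exact Or.inl ⟨hl, hm⟩
  · rintro (hl | hl)
    · exact hl.1
    · exact hF.isHalfLink_of_isMirrorLink hl

/-- **`siteLinkMap` carries positive links out of the closed half** (`P ≥ 2`). -/
theorem not_isHalfLink_siteLinkMap {l : Link A d} (hl : IsPosLink e k k P h l) :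
    ¬ IsHalfLink e P h (siteLinkMap e k θ l) := by
  obtain ⟨x, m⟩ := l
  obtain ⟨⟨h1, h2⟩, hm⟩ := hl
  have hP := hF.two_le
  have hcx := val_lt_two_mul hP (h x)
  unfold InHalf at h1 h2
  simp only at h1 h2
  intro h'
  obtain ⟨h3, h4⟩ := h'
  unfold InHalf at h3 h4
  by_cases hmk : m = k
  · subst hmk
    rw [siteLinkMap_self] at h3 h4
    simp only at h3 h4
    rw [sub_add_cancel, hF.val_height_map] at h4
    rw [hF.val_height_map_sub] at h3
    rw [hF.val_height_add_self] at h2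
    split_ifs at h2 h4 <;> omega
  · rw [siteLinkMap_other e k θ x hmk] at h3 h4
    simp only at h3 h4
    rw [hF.val_height_map] at h3
    rw [hF.map_add_other x hmk |>.symm, hF.height_map] at h4
    apply hm
    refine ⟨(hF.layer_iff_val x).2 ?_, hmk, hmk⟩
    split_ifs at h3 <;> omega

end IsSiteFrame

end TiltedRP

end Summit.QuantumFields.GaugeBoot
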